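import Mathlib
import HarnessLib

/-!
# Spectral bound ⇒ exponential growth bound for `e^{tT}` on a finite-dimensional complex space,
# and its transfer to real operators (Khalil, *Nonlinear Systems*, (4.11) / Theorem 4.5)

Topic `Literature/Analysis/ODE` (namespace `Literature.Analysis.ODE`).  Everything is PROVED (no
named fact, no definition, no instance, no `sorry`).  Companion of `LyapunovAdaptedInnerProduct.lean`,
which builds adapted inner products from EXPONENTIAL DICHOTOMY bounds; this file supplies those
bounds from the SPECTRUM — the finite-dimensional linear-algebra fact behind Khalil's (4.11)
"`exp(At) = P exp(Jt) P⁻¹ = Σᵢ Σₖ t^{k−1} exp(λᵢt) R_{ik}`" and Theorem 4.5 ("asymptotically stable iff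
`Re λᵢ < 0` for all eigenvalues") [Khalil2002, §4.3], equivalently Teschl's Cor. 3.6
(`‖exp(tA)‖ ≤ C e^{tα}` for every `α > max Re λⱼ`).  Mathlib has no Jordan/Schur form; the proof
runs on the generalized-eigenspace decomposition instead:

* `exp_smul_apply_of_pow_sub_eq_zero` — if `(T − μ)^k x = 0` then
  `e^{tT}x = e^{tμ} Σ_{j<k} (t^j/j!)(T − μ)^j x` (the exponential series truncates on a generalized
  eigenvector: `NormedSpace.exp_eq_tsum` + `ContinuousLinearMap.map_tsum` + `tsum_eq_sum`);
* `norm_exp_smul_apply_le_of_pow_sub_eq_zero` — hence `‖e^{tT}x‖ ≤ e^{tRe μ} k(1 + t‖T−μ‖)^k ‖x‖`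
  (`t ≥ 0`): polynomial times `e^{tRe μ}`, the content of (4.11);
* `exists_norm_exp_smul_le_of_eigenvalues_re_lt` — **all eigenvalues `Re μ < β` ⇒
  `‖e^{tT}‖ ≤ C e^{βt}` (`t ≥ 0`)**: decompose along `⨆_μ maxGenEigenspace μ = ⊤`
  (`Module.End.iSup_maxGenEigenspace_eq_top`, `independent_maxGenEigenspace`,
  `DirectSum.IsInternal.collectedBasis`), absorb the polynomial into `e^{(β − Re μ)t}`, and sum over a
  basis with bounded coordinate functionals;
* `exists_norm_exp_neg_smul_le_of_lt_eigenvalues_re` — all eigenvalues `Re μ > α` ⇒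
  `‖e^{−tT}‖ ≤ C e^{−αt}` (the theorem for `−T`);
* `norm_exp_smul_le_of_semiconj` — **transfer to a REAL operator** `A : E →L[ℝ] E` along a real-linear
  isometry `ι : E → F` into a complex space with `ι ∘ A = T ∘ ι` (a complexification):
  `ι(e^{tA}v) = e^{tT}(ιv)` and `‖e^{tA}‖ ≤ ‖e^{tT}‖`.  With the two theorems above this gives the
  exponential dichotomy of a real matrix whose complex eigenvalues have real parts in `(α, β)` — the
  hypothesis of `exists_adaptedCLM_of_expDichotomy`.

## Mathlib / tree search

Mathlib: `Module.End.iSup_maxGenEigenspace_eq_top`, `Module.End.independent_maxGenEigenspace`,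
`Module.End.mem_maxGenEigenspace`, `Module.End.hasUnifEigenvalue_iff_hasUnifEigenvalue_one`,
`DirectSum.isInternal_submodule_of_iSupIndep_of_iSup_eq_top`, `DirectSum.IsInternal.collectedBasis(_mem)`,
`FiniteDimensional.fintypeBasisIndex`, `LinearMap.toContinuousLinearMap`, `NormedSpace.exp_eq_tsum`,
`NormedSpace.expSeries_summable'`, `NormedSpace.exp_add_of_commute`, `algebraMap_exp_comm`,
`ContinuousLinearMap.map_tsum`, `Complex.norm_exp` (used).  `Mathlib/LinearAlgebra/Eigenspace/
Triangularizable.lean` records triangularization as a TODO; no spectral-mapping theorem for `exp`;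
`lean search 'norm_exp.*eigen|spectralRadius.*exp'` in the tree: nothing of this kind.

## References

* H. K. Khalil, *Nonlinear Systems*, 3rd ed., Prentice Hall 2002, §4.3 eq. (4.11) and Theorem 4.5
  (galaxy:panama:393504903659633 chunks p0096–p0097, read this session). [Khalil2002]
* G. Teschl, *Ordinary Differential Equations and Dynamical Systems*, GSM 140, AMS 2012, §3.2
  Cor. 3.6. [Teschl2012]
-/

noncomputable section

open NormedSpace Filter Topology
open scoped BigOperators

namespace Literature.Analysis.ODE

variable {F : Type*} [NormedAddCommGroup F] [NormedSpace ℂ F] [CompleteSpace F]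

/-- Polynomial × decaying exponential is bounded: `(1 + c t)^k ≤ (1 + c k/ε)^k e^{εt}` for `t ≥ 0`,
`c ≥ 0`, `ε > 0`. [folklore] -/
private theorem one_add_mul_pow_le_exp {c ε : ℝ} (hc : 0 ≤ c) (hε : 0 < ε) (k : ℕ) {t : ℝ}
    (ht : 0 ≤ t) : (1 + c * t) ^ k ≤ (1 + c * k / ε) ^ k * Real.exp (ε * t) := by
  rcases Nat.eq_zero_or_pos k with hk | hk
  · subst hk
    simp only [pow_zero, one_mul]
    exact Real.one_le_exp_iff.2 (by positivity)
  have hk' : (0 : ℝ) < k := by exact_mod_cast hk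
  -- `1 + c t ≤ (1 + c k / ε)(1 + (ε/k) t) ≤ (1 + c k/ε) e^{(ε/k) t}`
  have h1 : 1 + c * t ≤ (1 + c * k / ε) * (1 + ε / k * t) := by
    have : (1 + c * k / ε) * (1 + ε / k * t) = 1 + c * t + (ε / k * t + c * k / ε) := by
      field_simp; ring
    rw [this]
    have : 0 ≤ ε / k * t + c * k / ε := by positivity
    linarith
  have h2 : 1 + ε / k * t ≤ Real.exp (ε / k * t) := by
    have := Real.add_one_le_exp (ε / k * t); linarith
  have h3 : 1 + c * t ≤ (1 + c * k / ε) * Real.exp (ε / k * t) :=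
    h1.trans (mul_le_mul_of_nonneg_left h2 (by positivity))
  calc (1 + c * t) ^ k ≤ ((1 + c * k / ε) * Real.exp (ε / k * t)) ^ k :=
        pow_le_pow_left₀ (by positivity) h3 k
    _ = (1 + c * k / ε) ^ k * Real.exp (ε * t) := by
        rw [mul_pow, ← Real.exp_nat_mul]
        congr 2
        field_simp


omit [CompleteSpace F] in
/-- `‖N^j x‖ ≤ ‖N‖^j ‖x‖`. [folklore] -/
private theorem norm_pow_apply_le (N : F →L[ℂ] F) (x : F) (j : ℕ) : ‖(N ^ j) x‖ ≤ ‖N‖ ^ j * ‖x‖ := by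
  induction j with
  | zero => simp
  | succ j ih =>
    rw [pow_succ', pow_succ']
    change ‖N ((N ^ j) x)‖ ≤ _
    calc ‖N ((N ^ j) x)‖ ≤ ‖N‖ * ‖(N ^ j) x‖ := N.le_opNorm _
      _ ≤ ‖N‖ * (‖N‖ ^ j * ‖x‖) := mul_le_mul_of_nonneg_left ih (norm_nonneg _)
      _ = ‖N‖ * ‖N‖ ^ j * ‖x‖ := by ring

/-- **The exponential on a generalized eigenvector**: if `(T − μ)^k x = 0` then
`e^{tT} x = e^{tμ} Σ_{j<k} (t^j/j!) (T − μ)^j x` (finite sum) — the term structure of Khalil's (4.11). [cite: Khalil2002, §4.3 eq. (4.11)] -/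
theorem exp_smul_apply_of_pow_sub_eq_zero (T : F →L[ℂ] F) {μ : ℂ} {x : F} {k : ℕ}
    (hk : ((T - μ • (1 : F →L[ℂ] F)) ^ k) x = 0) (t : ℂ) :
    exp (t • T) x = Complex.exp (t * μ) •
      ∑ j ∈ Finset.range k, (t ^ j / (j.factorial : ℂ)) • (((T - μ • (1 : F →L[ℂ] F)) ^ j) x) := by
  set N : F →L[ℂ] F := T - μ • 1 with hN
  -- `tT = (tμ)•1 + t•N`, commuting
  have hsplit : t • T = (t * μ) • (1 : F →L[ℂ] F) + t • N := by
    rw [hN, smul_sub, smul_smul]; module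
  have hcomm : Commute ((t * μ) • (1 : F →L[ℂ] F)) (t • N) := ((Commute.one_left _).smul_left _)
  have hscal : exp ((t * μ) • (1 : F →L[ℂ] F)) = Complex.exp (t * μ) • (1 : F →L[ℂ] F) := by
    rw [← Algebra.algebraMap_eq_smul_one, ← Algebra.algebraMap_eq_smul_one, Complex.exp_eq_exp_ℂ,
      algebraMap_exp_comm]
  -- the nilpotent part: finite exponential sum on `x`
  have hvan : ∀ n, k ≤ n → ((N ^ n) x) = 0 := by
    intro n hn
    obtain ⟨m, rfl⟩ := Nat.exists_eq_add_of_le hn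
    rw [pow_add, pow_mul_comm]
    change (N ^ m) ((N ^ k) x) = 0
    rw [hk, map_zero]
  have hsum : exp (t • N) x = ∑ j ∈ Finset.range k, (t ^ j / (j.factorial : ℂ)) • ((N ^ j) x) := by
    rw [exp_eq_tsum (𝕂 := ℂ)]
    have hs : Summable fun n : ℕ => ((n.factorial : ℂ)⁻¹) • (t • N) ^ n := expSeries_summable' (𝕂 := ℂ) _
    rw [← ContinuousLinearMap.apply_apply x (∑' n, _), ContinuousLinearMap.map_tsum _ hs]
    simp only [ContinuousLinearMap.apply_apply]
    rw [tsum_eq_sum (s := Finset.range k)]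
    · refine Finset.sum_congr rfl fun j _ => ?_
      rw [smul_pow]
      change (j.factorial : ℂ)⁻¹ • (t ^ j • (N ^ j) x) = _
      rw [smul_smul]
      congr 1
      rw [div_eq_mul_inv, mul_comm]
    · intro n hn
      rw [Finset.mem_range, not_lt] at hn
      rw [smul_pow]
      change (n.factorial : ℂ)⁻¹ • (t ^ n • (N ^ n) x) = 0
      rw [hvan n hn, smul_zero, smul_zero]
  letI : NormedAlgebra ℚ (F →L[ℂ] F) := NormedAlgebra.restrictScalars ℚ ℂ (F →L[ℂ] F)
  rw [hsplit, exp_add_of_commute hcomm]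
  change exp ((t * μ) • (1 : F →L[ℂ] F)) (exp (t • N) x) = _
  rw [hsum, hscal]
  rfl

/-- **Norm growth on a generalized eigenvector**: `‖e^{tT}x‖ ≤ e^{t Re μ} · k(1 + t‖T−μ‖)^k · ‖x‖`
for `t ≥ 0` when `(T − μ)^k x = 0` (the terms `t^{k−1}e^{λᵢt}` of Khalil's (4.11)). [cite: Khalil2002, §4.3 eq. (4.11)] -/
theorem norm_exp_smul_apply_le_of_pow_sub_eq_zero (T : F →L[ℂ] F) {μ : ℂ} {x : F} {k : ℕ}
    (hk : ((T - μ • (1 : F →L[ℂ] F)) ^ k) x = 0) {t : ℝ} (ht : 0 ≤ t) :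
    ‖exp ((t : ℂ) • T) x‖ ≤
      Real.exp (μ.re * t) * (k * (1 + t * ‖T - μ • (1 : F →L[ℂ] F)‖) ^ k) * ‖x‖ := by
  set N : F →L[ℂ] F := T - μ • 1 with hN
  rw [exp_smul_apply_of_pow_sub_eq_zero T hk, norm_smul, Complex.norm_exp]
  have hre : ((t : ℂ) * μ).re = μ.re * t := by simp [Complex.mul_re]; ring
  rw [hre, mul_assoc]
  refine mul_le_mul_of_nonneg_left ?_ (Real.exp_nonneg _)
  have hb : 1 ≤ 1 + t * ‖N‖ := by nlinarith [norm_nonneg N]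
  calc ‖∑ j ∈ Finset.range k, ((t : ℂ) ^ j / (j.factorial : ℂ)) • ((N ^ j) x)‖
      ≤ ∑ j ∈ Finset.range k, ‖((t : ℂ) ^ j / (j.factorial : ℂ)) • ((N ^ j) x)‖ := norm_sum_le _ _
    _ ≤ ∑ j ∈ Finset.range k, (1 + t * ‖N‖) ^ k * ‖x‖ := by
        refine Finset.sum_le_sum fun j hj => ?_
        rw [Finset.mem_range] at hj
        rw [norm_smul, norm_div, norm_pow, Complex.norm_real, Real.norm_of_nonneg ht,
          Complex.norm_natCast]
        have hfac : (1 : ℝ) ≤ (j.factorial : ℝ) := by exact_mod_cast Nat.one_le_iff_ne_zero.2 (Nat.factorial_ne_zero j)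
        calc t ^ j / (j.factorial : ℝ) * ‖(N ^ j) x‖
            ≤ t ^ j / 1 * (‖N‖ ^ j * ‖x‖) := by
              gcongr
              · exact norm_pow_apply_le N x j
          _ = (t * ‖N‖) ^ j * ‖x‖ := by rw [div_one, mul_pow]; ring
          _ ≤ (1 + t * ‖N‖) ^ j * ‖x‖ := by
              gcongr; nlinarith [norm_nonneg N]
          _ ≤ (1 + t * ‖N‖) ^ k * ‖x‖ :=
              mul_le_mul_of_nonneg_right (pow_le_pow_right₀ hb hj.le) (norm_nonneg _)
    _ = (k * (1 + t * ‖N‖) ^ k) * ‖x‖ := by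
        rw [Finset.sum_const, Finset.card_range, nsmul_eq_mul]; ring


omit [CompleteSpace F] in
/-- Powers of a continuous linear map act as powers of the underlying linear map. [folklore] -/
private theorem pow_apply_eq_linearMap_pow_apply (S : F →L[ℂ] F) (k : ℕ) (x : F) :
    (S ^ k) x = ((S : F →ₗ[ℂ] F) ^ k) x := by
  induction k generalizing x with
  | zero => simp
  | succ k ih => rw [pow_succ, mul_apply_eq_comp, ih, pow_succ, Module.End.mul_apply]; rfl

/-- **Spectral bound ⇒ exponential growth bound** (Teschl, *ODE and Dynamical Systems*, Cor. 3.6: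
"`‖exp(tA)‖ ≤ C e^{tα}` for every `α > max Re λⱼ`"): on a finite-dimensional complex normed space,
if every eigenvalue `μ` of `T` has `Re μ < β`, then `‖e^{tT}‖ ≤ C e^{βt}` for `t ≥ 0`.  Proof via
the generalized-eigenspace decomposition (`Module.End.iSup_maxGenEigenspace_eq_top`) and
`norm_exp_smul_apply_le_of_pow_sub_eq_zero` on a basis adapted to it. [cite: Khalil2002, §4.3 eq. (4.11) and Theorem 4.5; Teschl2012, §3.2 Cor. 3.6] -/
theorem exists_norm_exp_smul_le_of_eigenvalues_re_lt [FiniteDimensional ℂ F] (T : F →L[ℂ] F) {β : ℝ}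
    (hβ : ∀ μ : ℂ, Module.End.HasEigenvalue (T : F →ₗ[ℂ] F) μ → μ.re < β) :
    ∃ C : ℝ, ∀ t : ℝ, 0 ≤ t → ‖exp ((t : ℂ) • T)‖ ≤ C * Real.exp (β * t) := by
  classical
  set f : Module.End ℂ F := (T : F →ₗ[ℂ] F) with hf
  have hind := Module.End.independent_maxGenEigenspace f
  have htop := Module.End.iSup_maxGenEigenspace_eq_top f
  have hInt : DirectSum.IsInternal (fun μ : ℂ => f.maxGenEigenspace μ) :=
    DirectSum.isInternal_submodule_of_iSupIndep_of_iSup_eq_top hind htop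
  -- a basis adapted to the decomposition
  let b : ∀ μ : ℂ, Module.Basis (Fin (Module.finrank ℂ (f.maxGenEigenspace μ))) ℂ (f.maxGenEigenspace μ) :=
    fun μ => Module.finBasis ℂ _
  set B := hInt.collectedBasis b with hB
  haveI : Fintype (Σ μ : ℂ, Fin (Module.finrank ℂ (f.maxGenEigenspace μ))) :=
    FiniteDimensional.fintypeBasisIndex B
  -- each basis vector is a generalized eigenvector with `Re μ < β`
  have hmem : ∀ i : (Σ μ : ℂ, Fin (Module.finrank ℂ (f.maxGenEigenspace μ))), B i ∈ f.maxGenEigenspace i.1 := fun i => hInt.collectedBasis_mem b i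
  have hre : ∀ i : (Σ μ : ℂ, Fin (Module.finrank ℂ (f.maxGenEigenspace μ))), (i.1 : ℂ).re < β := by
    intro i
    apply hβ
    have hne : f.maxGenEigenspace i.1 ≠ ⊥ := by
      intro hbot
      have : B i ∈ (⊥ : Submodule ℂ F) := hbot ▸ hmem i
      rw [Submodule.mem_bot] at this
      exact B.ne_zero i this
    exact (Module.End.hasUnifEigenvalue_iff_hasUnifEigenvalue_one (by simp : (0 : ℕ∞) < ⊤)).1 hne
  -- per-vector exponential bound
  have hvec : ∀ i : (Σ μ : ℂ, Fin (Module.finrank ℂ (f.maxGenEigenspace μ))), ∃ D : ℝ, 0 ≤ D ∧ ∀ t : ℝ, 0 ≤ t → ‖exp ((t : ℂ) • T) (B i)‖ ≤ D * Real.exp (β * t) := by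
    intro i
    obtain ⟨k, hk⟩ := (Module.End.mem_maxGenEigenspace f i.1 (B i)).1 (hmem i)
    have hk' : ((T - (i.1 : ℂ) • (1 : F →L[ℂ] F)) ^ k) (B i) = 0 := by
      rw [pow_apply_eq_linearMap_pow_apply]
      simpa [hf] using hk
    set c : ℝ := ‖T - (i.1 : ℂ) • (1 : F →L[ℂ] F)‖ with hc
    set ε : ℝ := β - (i.1 : ℂ).re with hε
    have hε0 : 0 < ε := by rw [hε]; linarith [hre i]
    refine ⟨k * (1 + c * k / ε) ^ k * ‖B i‖, by positivity, fun t ht => ?_⟩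
    have h1 := norm_exp_smul_apply_le_of_pow_sub_eq_zero T hk' ht
    have h2 := one_add_mul_pow_le_exp (norm_nonneg _ : 0 ≤ c) hε0 k ht
    calc ‖exp ((t : ℂ) • T) (B i)‖
        ≤ Real.exp ((i.1 : ℂ).re * t) * (k * (1 + t * c) ^ k) * ‖B i‖ := h1
      _ ≤ Real.exp ((i.1 : ℂ).re * t) * (k * ((1 + c * k / ε) ^ k * Real.exp (ε * t))) * ‖B i‖ := by
          gcongr
          rwa [mul_comm t c]
      _ = k * (1 + c * k / ε) ^ k * ‖B i‖ * (Real.exp ((i.1 : ℂ).re * t) * Real.exp (ε * t)) := by ring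
      _ = k * (1 + c * k / ε) ^ k * ‖B i‖ * Real.exp (β * t) := by
          rw [← Real.exp_add]; congr 2; rw [hε]; ring
  choose D hD0 hD using hvec
  -- coordinates are bounded
  set ℓ : (Σ μ : ℂ, Fin (Module.finrank ℂ (f.maxGenEigenspace μ))) → (F →L[ℂ] ℂ) :=
    fun i => LinearMap.toContinuousLinearMap (B.coord i) with hℓ
  have hℓ' : ∀ (i : (Σ μ : ℂ, Fin (Module.finrank ℂ (f.maxGenEigenspace μ)))) (x : F), B.repr x i = ℓ i x := fun i x => rfl
  refine ⟨∑ i, ‖ℓ i‖ * D i, fun t ht => ?_⟩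
  refine ContinuousLinearMap.opNorm_le_bound _
    (mul_nonneg (Finset.sum_nonneg fun i _ => mul_nonneg (norm_nonneg _) (hD0 i)) (Real.exp_nonneg _))
    fun x => ?_
  have hx : exp ((t : ℂ) • T) x = ∑ i, (B.repr x i) • exp ((t : ℂ) • T) (B i) := by
    conv_lhs => rw [← B.sum_repr x]
    rw [map_sum]
    simp only [map_smul]
  rw [hx]
  calc ‖∑ i, (B.repr x i) • exp ((t : ℂ) • T) (B i)‖
      ≤ ∑ i, ‖(B.repr x i) • exp ((t : ℂ) • T) (B i)‖ := norm_sum_le _ _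
    _ ≤ ∑ i, ‖ℓ i‖ * ‖x‖ * (D i * Real.exp (β * t)) := by
        refine Finset.sum_le_sum fun i _ => ?_
        rw [norm_smul, hℓ']
        exact mul_le_mul ((ℓ i).le_opNorm x) (hD i t ht) (norm_nonneg _) (by positivity)
    _ = (∑ i, ‖ℓ i‖ * D i) * Real.exp (β * t) * ‖x‖ := by
        rw [Finset.sum_mul, Finset.sum_mul]
        exact Finset.sum_congr rfl fun i _ => by ring


/-- **Lower growth bound**: if every eigenvalue `μ` of `T` has `α < Re μ`, then
`‖e^{−tT}‖ ≤ C e^{−αt}` for `t ≥ 0` (the previous theorem for `−T`). [cite: Khalil2002, §4.3 eq. (4.11) and Theorem 4.5] -/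
theorem exists_norm_exp_neg_smul_le_of_lt_eigenvalues_re [FiniteDimensional ℂ F] (T : F →L[ℂ] F) {α : ℝ}
    (hα : ∀ μ : ℂ, Module.End.HasEigenvalue (T : F →ₗ[ℂ] F) μ → α < μ.re) :
    ∃ C : ℝ, ∀ t : ℝ, 0 ≤ t → ‖exp (-((t : ℂ) • T))‖ ≤ C * Real.exp (-α * t) := by
  have hneg : ∀ ν : ℂ, Module.End.HasEigenvalue ((-T : F →L[ℂ] F) : F →ₗ[ℂ] F) ν → ν.re < -α := by
    intro ν hν
    obtain ⟨v, hv⟩ := hν.exists_hasEigenvector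
    have hv1 := hv.1
    rw [Module.End.mem_eigenspace_iff] at hv1
    -- `(-T) v = ν v`, so `T v = (-ν) v`
    have hT : Module.End.HasEigenvector (T : F →ₗ[ℂ] F) (-ν) v := by
      refine ⟨?_, hv.2⟩
      rw [Module.End.mem_eigenspace_iff, neg_smul, ← hv1]
      simp
    have := hα (-ν) (Module.End.hasEigenvalue_of_hasEigenvector hT)
    rw [Complex.neg_re] at this
    linarith
  obtain ⟨C, hC⟩ := exists_norm_exp_smul_le_of_eigenvalues_re_lt (-T) hneg
  refine ⟨C, fun t ht => ?_⟩
  have e : -((t : ℂ) • T) = (t : ℂ) • (-T) := by rw [smul_neg]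
  rw [e]
  simpa using hC t ht

/-! ## Transfer to a real operator along a complexification -/

/-- **Real operators: growth bounds transfer along an intertwining isometry into a complex space**
(the complexification of a real matrix).  If `ι : E → F` is a real-linear isometry into a complex
normed space with `ι ∘ A = T ∘ ι`, then `ι (e^{tA} v) = e^{tT} (ι v)` and `‖e^{tA}‖ ≤ ‖e^{tT}‖`
(Khalil's (4.11) is stated for REAL matrices through their complex Jordan form).
[cite: Khalil2002, §4.3 eq. (4.11)] -/
theorem norm_exp_smul_le_of_semiconj {E : Type*} [NormedAddCommGroup E] [NormedSpace ℝ E]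
    [CompleteSpace E] (ι : E →ₗᵢ[ℝ] F) (A : E →L[ℝ] E) (T : F →L[ℂ] F)
    (hι : ∀ v : E, ι (A v) = T (ι v)) (t : ℝ) :
    (∀ v : E, ι (exp (t • A) v) = exp ((t : ℂ) • T) (ι v)) ∧ ‖exp (t • A)‖ ≤ ‖exp ((t : ℂ) • T)‖ := by
  have hpow : ∀ (n : ℕ) (v : E), ι ((A ^ n) v) = (T ^ n) (ι v) := by
    intro n
    induction n with
    | zero => intro v; simp
    | succ n ih => intro v; rw [pow_succ, mul_apply_eq_comp, ih, hι, pow_succ, mul_apply_eq_comp]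
  have hconj : ∀ v : E, ι (exp (t • A) v) = exp ((t : ℂ) • T) (ι v) := by
    intro v
    have hsA : Summable fun n : ℕ => ((n.factorial : ℝ)⁻¹) • (t • A) ^ n := expSeries_summable' (𝕂 := ℝ) _
    have hsT : Summable fun n : ℕ => ((n.factorial : ℂ)⁻¹) • ((t : ℂ) • T) ^ n :=
      expSeries_summable' (𝕂 := ℂ) _
    have eA : exp (t • A) = ∑' n : ℕ, ((n.factorial : ℝ)⁻¹) • (t • A) ^ n :=
      congrFun (exp_eq_tsum (𝕂 := ℝ) (𝔸 := E →L[ℝ] E)) _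
    have eT : exp ((t : ℂ) • T) = ∑' n : ℕ, ((n.factorial : ℂ)⁻¹) • ((t : ℂ) • T) ^ n :=
      congrFun (exp_eq_tsum (𝕂 := ℂ) (𝔸 := F →L[ℂ] F)) _
    -- evaluate the series at `v`, resp. `ι v`
    have eAv : exp (t • A) v = ∑' n : ℕ, ((n.factorial : ℝ)⁻¹ * t ^ n) • (A ^ n) v := by
      rw [eA, ← ContinuousLinearMap.apply_apply v (∑' n : ℕ, _), ContinuousLinearMap.map_tsum _ hsA]
      refine tsum_congr fun n => ?_
      rw [ContinuousLinearMap.apply_apply, smul_pow, smul_apply, smul_apply, smul_smul]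
    have eTv : exp ((t : ℂ) • T) (ι v) = ∑' n : ℕ, (((n.factorial : ℝ)⁻¹ * t ^ n : ℝ) : ℂ) • (T ^ n) (ι v) := by
      rw [eT, ← ContinuousLinearMap.apply_apply (ι v) (∑' n : ℕ, _), ContinuousLinearMap.map_tsum _ hsT]
      refine tsum_congr fun n => ?_
      rw [ContinuousLinearMap.apply_apply, smul_pow, smul_apply, smul_apply, smul_smul]
      push_cast
      ring_nf
    have hsAv : Summable fun n : ℕ => ((n.factorial : ℝ)⁻¹ * t ^ n) • (A ^ n) v := by
      have := (ContinuousLinearMap.apply ℝ E v).summable hsA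
      refine this.congr fun n => ?_
      show ((((n.factorial : ℝ)⁻¹) • (t • A) ^ n) v) = _
      rw [smul_pow, smul_apply, smul_apply, smul_smul]
    rw [eAv, eTv]
    have hmap := (ι.toContinuousLinearMap).map_tsum hsAv
    rw [LinearIsometry.coe_toContinuousLinearMap] at hmap
    rw [hmap]
    refine tsum_congr fun n => ?_
    rw [LinearIsometry.map_smul, hpow, Complex.coe_smul]
  refine ⟨hconj, ?_⟩
  refine ContinuousLinearMap.opNorm_le_bound _ (norm_nonneg _) fun v => ?_
  calc ‖exp (t • A) v‖ = ‖ι (exp (t • A) v)‖ := (ι.norm_map _).symm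
    _ = ‖exp ((t : ℂ) • T) (ι v)‖ := by rw [hconj]
    _ ≤ ‖exp ((t : ℂ) • T)‖ * ‖ι v‖ := ContinuousLinearMap.le_opNorm _ _
    _ = ‖exp ((t : ℂ) • T)‖ * ‖v‖ := by rw [ι.norm_map]

end Literature.Analysis.ODE
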